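import Literature.AnabelianGeometry.SemiGraphs.TemperedPiActionLevel

/-!
# The action of `π₁^temp(𝒢)` on the fibre of a split covering ([SemiAnbd] Prop. 3.6 (ii), p. 38)

Sequel to `TemperedPiActionLevel.lean`: for Galois level data `D` and a covering `T` every
component of which is split by the levels `S n` from some level on (e.g. a TEMPERED covering under
the hypotheses of Prop. 3.6, `TemperedPiLevels.lean`), the group `π₁^temp(𝒢) = lim_n G_n` acts on
the fibre `T_{v₀}` through its projections `ρ_n : π₁^temp → G_n` (`piAct`, independent of the
level by `actAt_succ`), with open stabilisers — i.e. `T_{v₀}` is an object of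
`B^temp(π₁^temp(𝒢))` (`fibreObj`).  This is the object part of the equivalence
`B^temp(𝒢) ⥲ B^temp(π₁^temp(𝒢))` of [SemiAnbd] Prop. 3.6 (ii).
-/

namespace Literature.AnabelianGeometry.SemiGraphs

namespace ProfiniteSemiGraph

open CategoryTheory Topology

universe u

variable {𝒢 : ProfiniteSemiGraph.{u}}

namespace GaloisLevelData

variable (D : GaloisLevelData 𝒢) (h𝒢 : 𝒢.IsCountable) (T : CovObj 𝒢)
  (lev : (T.SV D.v₀).obj.V → ℕ)
  (hlev : ∀ (t : (T.SV D.v₀).obj.V) (n : ℕ), lev t ≤ n →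
    (D.S n).Splits (T.component (Sum.inl ⟨D.v₀, t⟩)))

/-- The action at any level `n ≥ lev t` through the projection `ρ_n`.
[cite: MochizukiSemiAnbd2006, Prop 3.6 p.38] -/
theorem actAt_proj_eq (t : (T.SV D.v₀).obj.V) (γ : D.temperedPi h𝒢) (n : ℕ) (hn : lev t ≤ n) :
    D.actAt h𝒢 T t n (hlev t n hn) (D.proj h𝒢 n γ) =
      D.actAt h𝒢 T t (lev t) (hlev t _ le_rfl) (D.proj h𝒢 (lev t) γ) := by
  induction n, hn using Nat.le_induction with
  | base => rfl
  | succ k hk ih =>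
    rw [← ih]
    have h1 : D.proj h𝒢 k γ = D.step h𝒢 k (D.proj h𝒢 (k + 1) γ) := by
      have := D.mapLE_proj h𝒢 (Nat.le_succ k) γ
      rw [D.mapLE_succ h𝒢 (le_refl k) (Nat.le_succ k), D.mapLE_self] at this
      exact this.symm
    rw [h1]
    exact D.actAt_succ h𝒢 T t k (hlev t k hk) (D.proj h𝒢 (k + 1) γ)

/-- **The action of `π₁^temp(𝒢)` on the fibre `T_{v₀}`**: `γ · t := actAt (lev t) (ρ_{lev t} γ) t`.
[cite: MochizukiSemiAnbd2006, Prop 3.6(ii) p.38] -/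
noncomputable def piAct (γ : D.temperedPi h𝒢) (t : (T.SV D.v₀).obj.V) : (T.SV D.v₀).obj.V :=
  D.actAt h𝒢 T t (lev t) (hlev t _ le_rfl) (D.proj h𝒢 (lev t) γ)

/-- `1 · t = t`. [cite: MochizukiSemiAnbd2006, Prop 3.6(ii) p.38] -/
theorem piAct_one (t : (T.SV D.v₀).obj.V) : D.piAct h𝒢 T lev hlev 1 t = t := by
  unfold piAct
  rw [map_one]
  exact D.actAt_one h𝒢 T t _ _

/-- The acted point lies in the same component. [cite: MochizukiSemiAnbd2006, Prop 3.6(ii) p.38] -/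
theorem sameComponent_piAct (γ : D.temperedPi h𝒢) (t : (T.SV D.v₀).obj.V) :
    T.SameComponent (Sum.inl ⟨D.v₀, t⟩) (Sum.inl ⟨D.v₀, D.piAct h𝒢 T lev hlev γ t⟩) :=
  D.sameComponent_actAt h𝒢 T t _ _ _

/-- `(γ δ) · t = γ · (δ · t)`. [cite: MochizukiSemiAnbd2006, Prop 3.6(ii) p.38] -/
theorem piAct_mul (γ δ : D.temperedPi h𝒢) (t : (T.SV D.v₀).obj.V) :
    D.piAct h𝒢 T lev hlev (γ * δ) t = D.piAct h𝒢 T lev hlev γ (D.piAct h𝒢 T lev hlev δ t) := by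
  -- work at a common level
  set t' := D.piAct h𝒢 T lev hlev δ t with ht'
  set N := max (lev t) (lev t') with hN
  have hNt : lev t ≤ N := le_max_left _ _
  have hNt' : lev t' ≤ N := le_max_right _ _
  unfold piAct
  rw [← D.actAt_proj_eq h𝒢 T lev hlev t (γ * δ) N hNt, ← D.actAt_proj_eq h𝒢 T lev hlev t' γ N hNt',
    map_mul]
  have hδ : D.actAt h𝒢 T t N (hlev t N hNt) (D.proj h𝒢 N δ) = t' := by
    rw [ht']
    unfold piAct
    exact D.actAt_proj_eq h𝒢 T lev hlev t δ N hNt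
  rw [D.actAt_mul h𝒢 T t N (hlev t N hNt) _ _ (D.splits_actAt h𝒢 T t N (hlev t N hNt) _)]
  exact D.actAt_congr h𝒢 T N hδ _ _ _

/-- The stabiliser of `t` contains the kernel of `ρ_{lev t}`. [cite: MochizukiSemiAnbd2006, Prop 3.6(ii) p.38] -/
theorem piAct_eq_self_of_proj_eq_one (γ : D.temperedPi h𝒢) (t : (T.SV D.v₀).obj.V)
    (hγ : D.proj h𝒢 (lev t) γ = 1) : D.piAct h𝒢 T lev hlev γ t = t := by
  unfold piAct
  rw [hγ]
  exact D.actAt_one h𝒢 T t _ _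

/-- **The fibre `T_{v₀}` as an object of `B^temp(π₁^temp(𝒢))`** (countable, with open stabilisers:
the stabiliser of `t` is a union of cosets of the open kernel of `ρ_{lev t}`).
[cite: MochizukiSemiAnbd2006, Prop 3.6(ii) p.38] -/
noncomputable def fibreObj : BTemp (D.temperedPi h𝒢) :=
  ⟨{ V := (T.SV D.v₀).obj.V
     ρ := { toFun := fun γ => TypeCat.ofHom (D.piAct h𝒢 T lev hlev γ)
            map_one' := by
              apply ConcreteCategory.hom_ext
              intro t
              exact D.piAct_one h𝒢 T lev hlev t
            map_mul' := fun γ δ => by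
              apply ConcreteCategory.hom_ext
              intro t
              exact D.piAct_mul h𝒢 T lev hlev γ δ t } },
    ⟨(T.SV D.v₀).property.1, fun t => by
      -- the stabiliser is a union of left cosets of the open kernel of `ρ_{lev t}`
      change IsOpen {γ : D.temperedPi h𝒢 | D.piAct h𝒢 T lev hlev γ t = t}
      have hK : IsOpen {γ : D.temperedPi h𝒢 | D.proj h𝒢 (lev t) γ = 1} :=
        (isOpen_discrete ({1} : Set (D.Gal h𝒢 (lev t)))).preimage (D.continuous_proj h𝒢 (lev t))
      rw [isOpen_iff_mem_nhds]
      intro γ hγ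
      -- the translate `γ · K` is a neighbourhood of `γ` contained in the stabiliser
      have hcont : Continuous fun δ : D.temperedPi h𝒢 => γ⁻¹ * δ := continuous_const.mul continuous_id
      have hopen : IsOpen ((fun δ : D.temperedPi h𝒢 => γ⁻¹ * δ) ⁻¹'
          {γ : D.temperedPi h𝒢 | D.proj h𝒢 (lev t) γ = 1}) := hK.preimage hcont
      refine Filter.mem_of_superset (hopen.mem_nhds ?_) ?_
      · change D.proj h𝒢 (lev t) (γ⁻¹ * γ) = 1
        rw [inv_mul_cancel, map_one]
      · intro δ hδ
        change D.proj h𝒢 (lev t) (γ⁻¹ * δ) = 1 at hδ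
        change D.piAct h𝒢 T lev hlev δ t = t
        have e : δ = γ * (γ⁻¹ * δ) := by rw [mul_inv_cancel_left]
        rw [e, D.piAct_mul, D.piAct_eq_self_of_proj_eq_one h𝒢 T lev hlev _ t hδ]
        exact hγ⟩⟩

end GaloisLevelData

end ProfiniteSemiGraph

end Literature.AnabelianGeometry.SemiGraphs
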